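import Literature.Topology.FourManifolds.WhiteheadStagePrelim
import Literature.Analysis.Convexity.SimplexTriangulationPure
import Literature.Analysis.Calculus.PiecewiseLipschitz
import Mathlib.Analysis.Calculus.InverseFunctionTheorem.ApproximatesLinearOn
import HarnessLib

/-!
# Whitehead triangulations, the bending step (Munkres 10.2–10.3), part A: data and constants

The input data of one straightening step and the uniform constants attached to it.
-/

open Set Function Metric Filter
open scoped Topology NNReal ContDiff Manifold

noncomputable section

-- `[T2Space M]` is a section variable used by most lemmas below; per-lemma `omit` would be noise.
set_option linter.unusedSectionVars false

namespace Literature.Topology.FourManifolds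

open Literature.Analysis.Convexity Literature.Analysis.Calculus

local notation "𝔼 " n:arg => EuclideanSpace ℝ (Fin n)

/-- **Input of the bending step.** A finite pure coordinate complex `K` in `ℝᴺ`, a map `f` into
the manifold, injective and simplexwise continuous on `K.space`, a chart `e`, smooth models of
`e ∘ f` on the top simplices, four compact levels `R₁ ⋐ R₂ ⊆ R₃ ⋐ R₄ ⊆ e.target` with margin
`η`, a smooth cut-off `θ` (`= 1` on `R₂`, `= 0` off `R₃`), a protected compact set `Prot` of
interior points of `f '' K.space`, and a requested tolerance `εreq`. (Bookkeeping structure, not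
a named fact; the intended instance is the data of one stage of the inductive construction of a
Whitehead triangulation — a canonical coordinate complex with its imbedding, one chart of the cover
and the models supplied by the previous stages, cf. `WhiteheadStagePrelim`.)
[cite: Munkres1966, 10.2–10.3] -/
structure BendInput (n N : ℕ) (M : Type*) [TopologicalSpace M] where
  /-- the complex -/
  K : Geometry.SimplicialComplex ℝ (Fin N → ℝ)
  hK : IsCoordinate K
  pure : ∀ r ∈ K.faces, ∃ s ∈ K.faces, r ⊆ s ∧ s.card = n + 1
  /-- the map into the manifold -/
  f : (Fin N → ℝ) → M
  inj : InjOn f K.space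
  cont : ∀ s ∈ K.faces, ContinuousOn f (convexHull ℝ (s : Set (Fin N → ℝ)))
  /-- the chart -/
  e : OpenPartialHomeomorph M (𝔼 n)
  model : ∀ s ∈ K.faces, s.card = n + 1 → ∃ O : Set (Fin N → ℝ), ∃ G : (Fin N → ℝ) → 𝔼 n,
    IsOpen O ∧ convexHull ℝ (s : Set (Fin N → ℝ)) ∩ f ⁻¹' e.source ⊆ O ∧ ContDiffOn ℝ ∞ G O ∧
    EqOn (e ∘ f) G (convexHull ℝ (s : Set (Fin N → ℝ)) ∩ f ⁻¹' e.source) ∧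
    ∀ x ∈ convexHull ℝ (s : Set (Fin N → ℝ)) ∩ f ⁻¹' e.source,
      ∀ u ∈ vectorSpan ℝ (s : Set (Fin N → ℝ)), fderiv ℝ G x u = 0 → u = 0
  /-- the levels -/
  R₁ : Set (𝔼 n)
  R₂ : Set (𝔼 n)
  R₃ : Set (𝔼 n)
  R₄ : Set (𝔼 n)
  hR₁ : IsCompact R₁
  hR₂ : IsCompact R₂
  hR₃ : IsCompact R₃
  hR₄ : IsCompact R₄
  η : ℝ
  hη : 0 < η
  h12 : cthickening η R₁ ⊆ R₂
  h23 : R₂ ⊆ R₃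
  h34 : cthickening η R₃ ⊆ R₄
  hR₄t : R₄ ⊆ e.target
  /-- the cut-off -/
  θ : 𝔼 n → ℝ
  hθ : ContDiff ℝ ∞ θ
  hθ01 : ∀ y, θ y ∈ Icc (0 : ℝ) 1
  hθ1 : ∀ y ∈ R₂, θ y = 1
  hθ0 : ∀ y ∉ R₃, θ y = 0
  /-- the protected set -/
  Prot : Set M
  hProt : IsCompact Prot
  hProtint : Prot ⊆ interior (f '' K.space)
  /-- the requested tolerance -/
  εreq : ℝ
  hεreq : 0 < εreq

namespace BendInput

variable {n N : ℕ} {M : Type*} [TopologicalSpace M] [T2Space M] (I : BendInput n N M)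

/-! ### Basic topology of the input -/

/-- The complex is finite. [folklore] -/
theorem faces_finite : I.K.faces.Finite := I.hK.faces_finite

/-- The underlying space is compact. [folklore] -/
theorem isCompact_space : IsCompact I.K.space := isCompact_space_of_finite I.faces_finite

/-- `f` is continuous on the underlying space. [folklore] -/
theorem continuousOn_f : ContinuousOn I.f I.K.space :=
  continuousOn_space_of_forall I.faces_finite I.cont

/-- The chart image `F = e ∘ f`. [folklore] -/
def F : (Fin N → ℝ) → 𝔼 n := fun x => I.e (I.f x)

/-- The domain where `F` is the genuine chart image: `K.space ∩ f ⁻¹' e.source`. [folklore] -/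
def D : Set (Fin N → ℝ) := I.K.space ∩ I.f ⁻¹' I.e.source

/-- `F` is continuous on `D`. [folklore] -/
theorem continuousOn_F : ContinuousOn I.F I.D :=
  I.e.continuousOn.comp (I.continuousOn_f.mono inter_subset_left) fun _ hx => hx.2

/-- `F` is injective on `D`. [folklore] -/
theorem injOn_F : InjOn I.F I.D := fun _ hx _ hy hxy =>
  I.inj hx.1 hy.1 (I.e.injOn hx.2 hy.2 hxy)

/-- The levels are nested: `R₁ ⊆ R₂ ⊆ R₃ ⊆ R₄ ⊆ e.target`. [folklore] -/
theorem R₁_subset_R₂ : I.R₁ ⊆ I.R₂ := (self_subset_cthickening _).trans I.h12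

/-- Auxiliary step of the bending construction (`R₃_subset_R₄`). [folklore] -/
theorem R₃_subset_R₄ : I.R₃ ⊆ I.R₄ := (self_subset_cthickening _).trans I.h34

/-- Auxiliary step of the bending construction (`R₂_subset_R₄`). [folklore] -/
theorem R₂_subset_R₄ : I.R₂ ⊆ I.R₄ := I.h23.trans I.R₃_subset_R₄

/-- Auxiliary step of the bending construction (`R₁_subset_R₄`). [folklore] -/
theorem R₁_subset_R₄ : I.R₁ ⊆ I.R₄ := I.R₁_subset_R₂.trans I.R₂_subset_R₄

/-- Auxiliary step of the bending construction (`R₃t`). [folklore] -/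
theorem R₃t : I.R₃ ⊆ I.e.target := I.R₃_subset_R₄.trans I.hR₄t

/-- Auxiliary step of the bending construction (`R₂t`). [folklore] -/
theorem R₂t : I.R₂ ⊆ I.e.target := I.R₂_subset_R₄.trans I.hR₄t

/-- Auxiliary step of the bending construction (`R₁t`). [folklore] -/
theorem R₁t : I.R₁ ⊆ I.e.target := I.R₁_subset_R₄.trans I.hR₄t

/-- The zone of `R₄` (and of the smaller levels) is compact. [folklore] -/
theorem isCompact_zone₄ : IsCompact (zone I.K I.f I.e I.R₄) :=
  isCompact_zone I.faces_finite I.cont I.hR₄ I.hR₄t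

/-- Auxiliary step of the bending construction (`isCompact_zone₃`). [folklore] -/
theorem isCompact_zone₃ : IsCompact (zone I.K I.f I.e I.R₃) :=
  isCompact_zone I.faces_finite I.cont I.hR₃ I.R₃t

/-- Auxiliary step of the bending construction (`isCompact_zone₂`). [folklore] -/
theorem isCompact_zone₂ : IsCompact (zone I.K I.f I.e I.R₂) :=
  isCompact_zone I.faces_finite I.cont I.hR₂ I.R₂t

/-- Auxiliary step of the bending construction (`isCompact_zone₁`). [folklore] -/
theorem isCompact_zone₁ : IsCompact (zone I.K I.f I.e I.R₁) :=
  isCompact_zone I.faces_finite I.cont I.hR₁ I.R₁t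

/-- The active region: the zone of `R₄`. [folklore] -/
def Zact : Set (Fin N → ℝ) := zone I.K I.f I.e I.R₄

/-- Zones lie in `D`. [folklore] -/
theorem zone_subset_D {R : Set (𝔼 n)} (hR : R ⊆ I.e.target) : zone I.K I.f I.e R ⊆ I.D :=
  fun _ hx => ⟨zone_subset_space hx, mem_source_of_mem_zone hR hx⟩

/-- Auxiliary step of the bending construction (`Zact_subset_D`). [folklore] -/
theorem Zact_subset_D : I.Zact ⊆ I.D := I.zone_subset_D I.hR₄t

/-- Membership in a zone via `F`. [folklore] -/
theorem mem_zone_iff_F {R : Set (𝔼 n)} (hR : R ⊆ I.e.target) {x : Fin N → ℝ} :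
    x ∈ zone I.K I.f I.e R ↔ x ∈ I.D ∧ I.F x ∈ R := by
  rw [mem_zone_iff hR]
  exact ⟨fun h => ⟨⟨h.1, h.2.1⟩, h.2.2⟩, fun h => ⟨h.1.1, h.1.2, h.2⟩⟩

/-- **Uniform margin of the zones inside `D`, with uniform continuity of `F`.** There is
`τ > 0` such that every point of `K.space` within sup-distance `τ` of the zone of `R₄` lies in
`D` and has `F`-value within `η'` of that of the nearby zone point, for any prescribed `η' > 0`.
[folklore] -/
theorem exists_tau {η' : ℝ} (hη' : 0 < η') :
    ∃ τ > 0, ∀ x ∈ zone I.K I.f I.e I.R₄, ∀ y ∈ I.K.space, dist y x ≤ τ →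
      y ∈ I.D ∧ dist (I.F y) (I.F x) ≤ η' := by
  -- `K.space \ D` is compact and disjoint from the compact zone
  have hZ : IsCompact (zone I.K I.f I.e I.R₄) := I.isCompact_zone₄
  have hZD : zone I.K I.f I.e I.R₄ ⊆ I.D := I.zone_subset_D I.hR₄t
  have hC : IsClosed (I.K.space ∩ I.f ⁻¹' I.e.sourceᶜ) :=
    I.continuousOn_f.preimage_isClosed_of_isClosed I.isCompact_space.isClosed I.e.open_source.isClosed_compl
  -- a uniform margin `τ₁`: the `τ₁`-neighbourhood of the zone in `K.space` lies in `D`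
  obtain ⟨τ₁, hτ₁, hτ₁D⟩ : ∃ τ₁ > 0, ∀ x ∈ zone I.K I.f I.e I.R₄, ∀ y ∈ I.K.space,
      dist y x ≤ τ₁ → y ∈ I.D := by
    have hdisj : Disjoint (zone I.K I.f I.e I.R₄) (I.K.space ∩ I.f ⁻¹' I.e.sourceᶜ) := by
      rw [Set.disjoint_left]
      intro x hx hx'
      exact hx'.2 (hZD hx).2
    obtain ⟨r, hr, hrU⟩ := hZ.exists_cthickening_subset_open hC.isOpen_compl
      (fun x hx hx' => Set.disjoint_left.1 hdisj hx hx')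
    refine ⟨r, hr, fun x hx y hy hyx => ⟨hy, ?_⟩⟩
    by_contra hsrc
    have hyU : y ∈ cthickening r (zone I.K I.f I.e I.R₄) :=
      mem_cthickening_of_dist_le y x r _ hx hyx
    exact hrU hyU ⟨hy, hsrc⟩
  -- the compact neighbourhood `S = K.space ∩ cthickening τ₁ zone ⊆ D`
  set S : Set (Fin N → ℝ) := I.K.space ∩ cthickening τ₁ (zone I.K I.f I.e I.R₄) with hS
  have hSc : IsCompact S := I.isCompact_space.inter_right isClosed_cthickening
  have hmemS : ∀ y, y ∈ S ↔ y ∈ I.K.space ∧ ∃ x ∈ zone I.K I.f I.e I.R₄, dist y x ≤ τ₁ := by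
    intro y
    rw [hS, hZ.cthickening_eq_biUnion_closedBall hτ₁.le]
    simp only [mem_inter_iff, mem_iUnion, mem_closedBall, exists_prop]
  have hSD : S ⊆ I.D := fun y hy => by
    obtain ⟨hyK, x, hx, hyx⟩ := (hmemS y).1 hy
    exact hτ₁D x hx y hyK hyx
  have hZS : zone I.K I.f I.e I.R₄ ⊆ S := fun x hx =>
    (hmemS x).2 ⟨zone_subset_space hx, x, hx, by rw [dist_self]; exact hτ₁.le⟩
  -- uniform continuity of `F` on `S`
  have huc : UniformContinuousOn I.F S := hSc.uniformContinuousOn_of_continuous (I.continuousOn_F.mono hSD)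
  obtain ⟨τ₂, hτ₂, hτ₂F⟩ := Metric.uniformContinuousOn_iff.1 huc η' hη'
  refine ⟨min τ₁ (τ₂ / 2), lt_min hτ₁ (half_pos hτ₂), fun x hx y hy hyx => ?_⟩
  have hyS : y ∈ S := (hmemS y).2 ⟨hy, x, hx, hyx.trans (min_le_left _ _)⟩
  refine ⟨hSD hyS, (hτ₂F y hyS x (hZS hx) (hyx.trans_lt ?_)).le⟩
  exact (min_le_right _ _).trans_lt (half_lt_self hτ₂)

/-- **Small sets near a zone stay in a slightly larger zone.** With `τ` as in `exists_tau` for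
`η'`: a subset of `K.space` of diameter `≤ τ` meeting the zone of `R ⊆ R₄` lies in the zone of
`cthickening η' R` (provided the latter lies in the chart target). [folklore] -/
theorem subset_zone_of_small {τ η' : ℝ}
    (hτ : ∀ x ∈ zone I.K I.f I.e I.R₄, ∀ y ∈ I.K.space, dist y x ≤ τ → y ∈ I.D ∧ dist (I.F y) (I.F x) ≤ η')
    {T : Set (Fin N → ℝ)} (hTK : T ⊆ I.K.space) (hdiam : ∀ x ∈ T, ∀ y ∈ T, dist y x ≤ τ)
    {R : Set (𝔼 n)} (hR4 : R ⊆ I.R₄) (hR't : cthickening η' R ⊆ I.e.target)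
    (hmeet : (T ∩ zone I.K I.f I.e R).Nonempty) : T ⊆ zone I.K I.f I.e (cthickening η' R) := by
  obtain ⟨x, hxT, hxZ⟩ := hmeet
  have hx4 : x ∈ zone I.K I.f I.e I.R₄ := zone_mono hR4 hxZ
  intro y hy
  obtain ⟨hyD, hdist⟩ := hτ x hx4 y (hTK hy) (hdiam x hxT y hy)
  rw [I.mem_zone_iff_F hR't]
  refine ⟨hyD, mem_cthickening_of_dist_le _ (I.F x) _ _ ?_ hdist⟩
  exact ((I.mem_zone_iff_F (hR4.trans I.hR₄t)).1 hxZ).2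

/-! ### Models and uniform constants -/

/-- The top simplices. [folklore] -/
def Top : Set (Finset (Fin N → ℝ)) := {s | s ∈ I.K.faces ∧ s.card = n + 1}

/-- Auxiliary step of the bending construction (`top_finite`). [folklore] -/
theorem top_finite : I.Top.Finite := I.faces_finite.subset fun _ hs => hs.1

/-- **Models with uniform constants.** Smooth chart models `G s` of `e ∘ f` on the top simplices,
with constants `B₁, B₂, μ, μ'` valid uniformly on `Q s = convexHull s ∩ zone R₄`. [folklore] -/
theorem exists_models_constants :
    ∃ (O : Finset (Fin N → ℝ) → Set (Fin N → ℝ)) (G : Finset (Fin N → ℝ) → (Fin N → ℝ) → 𝔼 n)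
      (B₁ B₂ : ℝ≥0) (μ μ' : ℝ), 0 < μ ∧ 0 < μ' ∧ ∀ s ∈ I.Top,
      IsOpen (O s) ∧ convexHull ℝ (s : Set (Fin N → ℝ)) ∩ I.f ⁻¹' I.e.source ⊆ O s ∧
      ContDiffOn ℝ ∞ (G s) (O s) ∧
      EqOn (I.e ∘ I.f) (G s) (convexHull ℝ (s : Set (Fin N → ℝ)) ∩ I.f ⁻¹' I.e.source) ∧
      (∀ x ∈ convexHull ℝ (s : Set (Fin N → ℝ)) ∩ I.f ⁻¹' I.e.source,
        ∀ u ∈ vectorSpan ℝ (s : Set (Fin N → ℝ)), fderiv ℝ (G s) x u = 0 → u = 0) ∧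
      (∀ x ∈ convexHull ℝ (s : Set (Fin N → ℝ)) ∩ zone I.K I.f I.e I.R₄, ‖fderiv ℝ (G s) x‖ ≤ B₁) ∧
      (∀ S, Convex ℝ S → S ⊆ convexHull ℝ (s : Set (Fin N → ℝ)) ∩ zone I.K I.f I.e I.R₄ →
        LipschitzOnWith B₁ (G s) S ∧ LipschitzOnWith B₂ (fderiv ℝ (G s)) S) ∧
      (∀ x ∈ convexHull ℝ (s : Set (Fin N → ℝ)) ∩ zone I.K I.f I.e I.R₄,
        ∀ u ∈ vectorSpan ℝ (s : Set (Fin N → ℝ)), μ * ‖u‖ ≤ ‖fderiv ℝ (G s) x u‖) ∧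
      (∀ x ∈ convexHull ℝ (s : Set (Fin N → ℝ)) ∩ zone I.K I.f I.e I.R₄,
        ∀ y ∈ convexHull ℝ (s : Set (Fin N → ℝ)) ∩ zone I.K I.f I.e I.R₄,
          μ' * ‖x - y‖ ≤ ‖G s x - G s y‖) := by
  classical
  -- choose the models
  have hmod : ∀ s ∈ I.Top, ∃ O : Set (Fin N → ℝ), ∃ G : (Fin N → ℝ) → 𝔼 n,
      IsOpen O ∧ convexHull ℝ (s : Set (Fin N → ℝ)) ∩ I.f ⁻¹' I.e.source ⊆ O ∧ ContDiffOn ℝ ∞ G O ∧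
      EqOn (I.e ∘ I.f) G (convexHull ℝ (s : Set (Fin N → ℝ)) ∩ I.f ⁻¹' I.e.source) ∧
      ∀ x ∈ convexHull ℝ (s : Set (Fin N → ℝ)) ∩ I.f ⁻¹' I.e.source,
        ∀ u ∈ vectorSpan ℝ (s : Set (Fin N → ℝ)), fderiv ℝ G x u = 0 → u = 0 :=
    fun s hs => I.model s hs.1 hs.2
  choose! O G hO hsO hG hGf hGinj using hmod
  -- constants for each top simplex
  have hcst : ∀ s ∈ I.Top, ∃ ρ > 0, ∃ B₁ B₂ : ℝ≥0, ∃ μ > 0, ∃ μ' > 0,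
      cthickening ρ (convexHull ℝ (s : Set (Fin N → ℝ)) ∩ zone I.K I.f I.e I.R₄) ⊆ O s ∧
      (∀ x ∈ cthickening ρ (convexHull ℝ (s : Set (Fin N → ℝ)) ∩ zone I.K I.f I.e I.R₄),
        ‖fderiv ℝ (G s) x‖ ≤ B₁) ∧
      (∀ S, Convex ℝ S → S ⊆ cthickening ρ (convexHull ℝ (s : Set (Fin N → ℝ)) ∩ zone I.K I.f I.e I.R₄) →
        LipschitzOnWith B₁ (G s) S ∧ LipschitzOnWith B₂ (fderiv ℝ (G s)) S) ∧
      (∀ x ∈ convexHull ℝ (s : Set (Fin N → ℝ)) ∩ zone I.K I.f I.e I.R₄,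
        ∀ u ∈ vectorSpan ℝ (s : Set (Fin N → ℝ)), μ * ‖u‖ ≤ ‖fderiv ℝ (G s) x u‖) ∧
      (∀ x ∈ convexHull ℝ (s : Set (Fin N → ℝ)) ∩ zone I.K I.f I.e I.R₄,
        ∀ y ∈ convexHull ℝ (s : Set (Fin N → ℝ)) ∩ zone I.K I.f I.e I.R₄, μ' * ‖x - y‖ ≤ ‖G s x - G s y‖) :=
    fun s hs => exists_simplex_constants I.inj I.hR₄t I.isCompact_zone₄ (hO s hs) (hsO s hs) (hG s hs)
      (hGf s hs) (hGinj s hs)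
  choose! ρ hρ B₁ B₂ μ hμ μ' hμ' hρO hB₁ hLip hμle hμ'le using hcst
  -- uniformise
  obtain ⟨C₁, hC₁0, hC₁⟩ := exists_forall_le_of_finite I.top_finite fun s => (B₁ s : ℝ)
  obtain ⟨C₂, hC₂0, hC₂⟩ := exists_forall_le_of_finite I.top_finite fun s => (B₂ s : ℝ)
  obtain ⟨m₁, hm₁, hm₁P⟩ := exists_pos_forall_of_finite I.top_finite
    (P := fun s r => ∀ x ∈ convexHull ℝ (s : Set (Fin N → ℝ)) ∩ zone I.K I.f I.e I.R₄,
      ∀ u ∈ vectorSpan ℝ (s : Set (Fin N → ℝ)), r * ‖u‖ ≤ ‖fderiv ℝ (G s) x u‖)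
    (fun s _ r r' hr' hle h x hx u hu => (mul_le_mul_of_nonneg_right hle (norm_nonneg _)).trans (h x hx u hu))
    (fun s hs => ⟨μ s, hμ s hs, hμle s hs⟩)
  obtain ⟨m₂, hm₂, hm₂P⟩ := exists_pos_forall_of_finite I.top_finite
    (P := fun s r => ∀ x ∈ convexHull ℝ (s : Set (Fin N → ℝ)) ∩ zone I.K I.f I.e I.R₄,
      ∀ y ∈ convexHull ℝ (s : Set (Fin N → ℝ)) ∩ zone I.K I.f I.e I.R₄, r * ‖x - y‖ ≤ ‖G s x - G s y‖)
    (fun s _ r r' hr' hle h x hx y hy => (mul_le_mul_of_nonneg_right hle (norm_nonneg _)).trans (h x hx y hy))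
    (fun s hs => ⟨μ' s, hμ' s hs, hμ'le s hs⟩)
  refine ⟨O, G, ⟨C₁, hC₁0⟩, ⟨C₂, hC₂0⟩, m₁, m₂, hm₁, hm₂, fun s hs => ⟨hO s hs, hsO s hs, hG s hs, hGf s hs,
    hGinj s hs, fun x hx => ?_, fun S hS hSQ => ⟨?_, ?_⟩, hm₁P s hs, hm₂P s hs⟩⟩
  · exact (hB₁ s hs x (self_subset_cthickening _ hx)).trans (hC₁ s hs)
  · exact ((hLip s hs S hS (hSQ.trans (self_subset_cthickening _))).1).weaken (by exact_mod_cast hC₁ s hs)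
  · exact ((hLip s hs S hS (hSQ.trans (self_subset_cthickening _))).2).weaken (by exact_mod_cast hC₂ s hs)

/-- **Bound on the derivative of the cut-off.** [folklore] -/
theorem exists_Theta : ∃ Θ : ℝ, 0 ≤ Θ ∧ ∀ y, ‖fderiv ℝ I.θ y‖ ≤ Θ := by
  have hsupp : HasCompactSupport I.θ := HasCompactSupport.intro I.hR₃ fun y hy => I.hθ0 y hy
  obtain ⟨C, hC⟩ := (hsupp.fderiv (𝕜 := ℝ)).exists_bound_of_continuous (I.hθ.continuous_fderiv (by simp))
  exact ⟨max C 0, le_max_right _ _, fun y => (hC y).trans (le_max_left _ _)⟩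

/-- The chart image of the complex: `Y = e '' (f '' K.space ∩ e.source) = F '' D`. [folklore] -/
def Y : Set (𝔼 n) := I.F '' I.D

/-- `Y` is the `e`-image of `f '' K.space ∩ e.source`. [folklore] -/
theorem Y_eq : I.Y = I.e '' (I.f '' I.K.space ∩ I.e.source) := by
  ext z
  simp only [Y, D, F, mem_image, mem_inter_iff, mem_preimage]
  constructor
  · rintro ⟨x, ⟨hxK, hsrc⟩, rfl⟩
    exact ⟨I.f x, ⟨⟨x, hxK, rfl⟩, hsrc⟩, rfl⟩
  · rintro ⟨_, ⟨⟨x, hxK, rfl⟩, hsrc⟩, rfl⟩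
    exact ⟨x, ⟨hxK, hsrc⟩, rfl⟩

/-- **Protected margin.** There is `ρP > 0` such that for every protected point `p` in the zone of
`R₄` the closed ball of radius `ρP` about `e p` lies in `Y`. [folklore] -/
theorem exists_rhoP : ∃ ρP > 0, ∀ p ∈ I.Prot, p ∈ I.e.source → I.e p ∈ I.R₄ →
    closedBall (I.e p) ρP ⊆ I.Y := by
  -- the open set `U = e '' (interior (f '' K.space) ∩ e.source) ⊆ Y`
  set U : Set (𝔼 n) := I.e '' (interior (I.f '' I.K.space) ∩ I.e.source) with hU
  have hUo : IsOpen U := I.e.isOpen_image_of_subset_source (isOpen_interior.inter I.e.open_source)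
    inter_subset_right
  have hUY : U ⊆ I.Y := by
    rw [I.Y_eq]
    exact image_mono (inter_subset_inter_left _ interior_subset)
  -- the compact set `Π = e '' (Prot ∩ e.symm '' R₄) ⊆ U`
  set PP : Set (𝔼 n) := I.e '' (I.Prot ∩ I.e.symm '' I.R₄) with hPP
  have hPPc : IsCompact PP := by
    refine (I.hProt.inter_right ?_).image_of_continuousOn (I.e.continuousOn.mono ?_)
    · exact (I.hR₄.image_of_continuousOn (I.e.continuousOn_symm.mono I.hR₄t)).isClosed
    · rintro p ⟨-, y, hy, rfl⟩
      exact I.e.map_target (I.hR₄t hy)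
  have hPPU : PP ⊆ U := by
    rintro _ ⟨p, ⟨hp, y, hy, rfl⟩, rfl⟩
    exact ⟨I.e.symm y, ⟨I.hProtint hp, I.e.map_target (I.hR₄t hy)⟩, rfl⟩
  obtain ⟨r, hr, hrU⟩ := hPPc.exists_cthickening_subset_open hUo hPPU
  refine ⟨r, hr, fun p hp hsrc hp4 => ?_⟩
  have hep : I.e p ∈ PP := ⟨p, ⟨hp, I.e p, hp4, I.e.left_inv hsrc⟩, rfl⟩
  exact ((closedBall_subset_cthickening hep r).trans hrU).trans hUY

/-! ### The set-up: all choices and the fineness `m` -/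

/-- Elementary: `L / m ≤ r` once `L / r ≤ m`. [folklore] -/
theorem div_nat_le {L r : ℝ} (hr : 0 < r) {m : ℕ} (hm0 : 0 < m) (hm : L / r ≤ m) :
    L / m ≤ r := by
  have hm' : (0 : ℝ) < m := by exact_mod_cast hm0
  rw [div_le_iff₀ hm']
  rw [div_le_iff₀ hr] at hm
  linarith [mul_comm r (m : ℝ)]

/-- **The set-up of the bending step**: the chosen models and all constants, and a fineness `m`
small enough for every estimate of the step. (Bookkeeping structure, not a named fact.)
[folklore] -/
structure BendSetup (I : BendInput n N M) where
  /-- models -/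
  O : Finset (Fin N → ℝ) → Set (Fin N → ℝ)
  G : Finset (Fin N → ℝ) → (Fin N → ℝ) → 𝔼 n
  /-- constants -/
  B₁ : ℝ≥0
  B₂ : ℝ≥0
  μ : ℝ
  μ' : ℝ
  Θ : ℝ
  c : ℝ
  ρP : ℝ
  τ : ℝ
  m : ℕ
  hμ : 0 < μ
  hμ' : 0 < μ'
  hΘ : 0 ≤ Θ
  hc : 0 < c
  hρP : 0 < ρP
  hτ : 0 < τ
  hm : 0 < m
  hmodel : ∀ s ∈ I.Top,
    IsOpen (O s) ∧ convexHull ℝ (s : Set (Fin N → ℝ)) ∩ I.f ⁻¹' I.e.source ⊆ O s ∧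
    ContDiffOn ℝ ∞ (G s) (O s) ∧
    EqOn (I.e ∘ I.f) (G s) (convexHull ℝ (s : Set (Fin N → ℝ)) ∩ I.f ⁻¹' I.e.source) ∧
    (∀ x ∈ convexHull ℝ (s : Set (Fin N → ℝ)) ∩ I.f ⁻¹' I.e.source,
      ∀ u ∈ vectorSpan ℝ (s : Set (Fin N → ℝ)), fderiv ℝ (G s) x u = 0 → u = 0) ∧
    (∀ x ∈ convexHull ℝ (s : Set (Fin N → ℝ)) ∩ zone I.K I.f I.e I.R₄, ‖fderiv ℝ (G s) x‖ ≤ B₁) ∧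
    (∀ S, Convex ℝ S → S ⊆ convexHull ℝ (s : Set (Fin N → ℝ)) ∩ zone I.K I.f I.e I.R₄ →
      LipschitzOnWith B₁ (G s) S ∧ LipschitzOnWith B₂ (fderiv ℝ (G s)) S) ∧
    (∀ x ∈ convexHull ℝ (s : Set (Fin N → ℝ)) ∩ zone I.K I.f I.e I.R₄,
      ∀ u ∈ vectorSpan ℝ (s : Set (Fin N → ℝ)), μ * ‖u‖ ≤ ‖fderiv ℝ (G s) x u‖) ∧
    (∀ x ∈ convexHull ℝ (s : Set (Fin N → ℝ)) ∩ zone I.K I.f I.e I.R₄,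
      ∀ y ∈ convexHull ℝ (s : Set (Fin N → ℝ)) ∩ zone I.K I.f I.e I.R₄, μ' * ‖x - y‖ ≤ ‖G s x - G s y‖)
  hΘb : ∀ y, ‖fderiv ℝ I.θ y‖ ≤ Θ
  hcnd : ∀ t : Finset (Fin N → ℝ), (∀ v ∈ t, ∀ i, ∃ z : ℤ, |z| ≤ ((N + 1 : ℕ) : ℤ) ∧ v i = z) →
    AffineIndependent ℝ ((↑) : t → (Fin N → ℝ)) → Nondegenerate c t
  hρPb : ∀ p ∈ I.Prot, p ∈ I.e.source → I.e p ∈ I.R₄ → closedBall (I.e p) ρP ⊆ I.Y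
  hτb : ∀ x ∈ zone I.K I.f I.e I.R₄, ∀ y ∈ I.K.space, dist y x ≤ τ →
    y ∈ I.D ∧ dist (I.F y) (I.F x) ≤ min (min I.η I.εreq / 4) (ρP / 4)
  /-- fineness -/
  hm_τ : (1 : ℝ) / m ≤ τ
  hm_δ : (B₁ : ℝ) / m ≤ min (min (ρP / 4) (I.η / 8) / 8) I.εreq
  hm_A : ((((n : ℝ) + 1) * (B₂ : ℝ) / c + (B₂ : ℝ)) / μ' + Θ * (B₁ : ℝ)) / m ≤ 1 / 4
  hm_K : (Θ * (B₁ : ℝ) * (B₁ : ℝ) + ((n : ℝ) + 1) * ((n : ℝ) + 1) * (B₂ : ℝ) / c / c) / m ≤ μ / 2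

/-- **The set-up exists.** [folklore] -/
theorem exists_setup : Nonempty (BendSetup I) := by
  obtain ⟨O, G, B₁, B₂, μ, μ', hμ, hμ', hmodel⟩ := I.exists_models_constants
  obtain ⟨Θ, hΘ, hΘb⟩ := I.exists_Theta
  obtain ⟨c, hc, hcnd⟩ := exists_pos_forall_nondegenerate_of_int N (N + 1)
  obtain ⟨ρP, hρP, hρPb⟩ := I.exists_rhoP
  have hη' : 0 < min (min I.η I.εreq / 4) (ρP / 4) := by
    have := lt_min I.hη I.hεreq
    exact lt_min (by positivity) (by positivity)
  obtain ⟨τ, hτ, hτb⟩ := I.exists_tau hη'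
  -- the thresholds
  set δmax : ℝ := min (min (ρP / 4) (I.η / 8) / 8) I.εreq with hδmax
  have hδmax0 : 0 < δmax := by
    have h1 : 0 < min (ρP / 4) (I.η / 8) := lt_min (by positivity) (by linarith [I.hη])
    exact lt_min (by positivity) I.hεreq
  set Acoef : ℝ := (((n : ℝ) + 1) * (B₂ : ℝ) / c + (B₂ : ℝ)) / μ' + Θ * (B₁ : ℝ) with hA
  have hA0 : 0 ≤ Acoef := by positivity
  set Kcoef : ℝ := Θ * (B₁ : ℝ) * (B₁ : ℝ) + ((n : ℝ) + 1) * ((n : ℝ) + 1) * (B₂ : ℝ) / c / c with hKc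
  have hK0 : 0 ≤ Kcoef := by positivity
  obtain ⟨m, hm⟩ := exists_nat_gt (max (max (1 / τ) (B₁ / δmax)) (max (Acoef / (1 / 4)) (Kcoef / (μ / 2))))
  have hm0 : 0 < m := by
    have : (0 : ℝ) < m := lt_of_le_of_lt (le_max_of_le_left (le_max_of_le_left (by positivity))) hm
    exact_mod_cast this
  refine ⟨⟨O, G, B₁, B₂, μ, μ', Θ, c, ρP, τ, m, hμ, hμ', hΘ, hc, hρP, hτ, hm0, hmodel, hΘb, hcnd, hρPb, hτb,
    ?_, ?_, ?_, ?_⟩⟩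
  · exact div_nat_le hτ hm0 ((le_max_left _ _).trans ((le_max_left _ _).trans hm.le))
  · exact div_nat_le hδmax0 hm0 ((le_max_right _ _).trans ((le_max_left _ _).trans hm.le))
  · exact div_nat_le (by norm_num) hm0 ((le_max_left _ _).trans ((le_max_right _ _).trans hm.le))
  · exact div_nat_le (half_pos hμ) hm0 ((le_max_right _ _).trans ((le_max_right _ _).trans hm.le))

namespace BendSetup

variable {I} (S : BendSetup I)

/-! ### The refinement -/

/-- The lattice refinement of fineness `m`. [folklore] -/
def P : Geometry.SimplicialComplex ℝ (Fin N → ℝ) := latticeRefinement I.K S.m S.hm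

/-- Auxiliary step of the bending construction (`P_finite`). [folklore] -/
theorem P_finite : S.P.faces.Finite := latticeRefinement_faces_finite

/-- Auxiliary step of the bending construction (`P_space`). [folklore] -/
theorem P_space : S.P.space = I.K.space := latticeRefinement_space I.hK

/-- Every simplex of the refinement lies in a top simplex of `K`. [folklore] -/
theorem exists_top_of_mem_P {t : Finset (Fin N → ℝ)} (ht : t ∈ S.P.faces) :
    ∃ s ∈ I.Top, convexHull ℝ (t : Set (Fin N → ℝ)) ⊆ convexHull ℝ (s : Set (Fin N → ℝ)) := by
  obtain ⟨r, hr, htr⟩ := exists_convexHull_subset_of_mem_latticeRefinement I.hK ht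
  obtain ⟨s, hs, hrs, hcard⟩ := I.pure r hr
  exact ⟨s, ⟨hs, hcard⟩, htr.trans (convexHull_mono (by exact_mod_cast hrs))⟩

/-- Simplexwise covering of the simplices of `K` by the refinement. [folklore] -/
theorem exists_mem_P_of_mem {s : Finset (Fin N → ℝ)} (hs : s ∈ I.K.faces) {x : Fin N → ℝ}
    (hx : x ∈ convexHull ℝ (s : Set (Fin N → ℝ))) :
    ∃ t ∈ S.P.faces, x ∈ convexHull ℝ (t : Set (Fin N → ℝ)) ∧
      convexHull ℝ (t : Set (Fin N → ℝ)) ⊆ convexHull ℝ (s : Set (Fin N → ℝ)) :=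
  exists_mem_latticeRefinement_of_mem I.hK hs hx

/-- Mesh of the refinement in the sup metric: `dist x y ≤ 1/m` on each closed simplex. [folklore] -/
theorem dist_le_of_mem_P {t : Finset (Fin N → ℝ)} (ht : t ∈ S.P.faces) {x y : Fin N → ℝ}
    (hx : x ∈ convexHull ℝ (t : Set (Fin N → ℝ))) (hy : y ∈ convexHull ℝ (t : Set (Fin N → ℝ))) :
    dist x y ≤ 1 / S.m := by
  have hm : (0 : ℝ) ≤ 1 / S.m := by positivity
  rw [dist_pi_le_iff hm]
  intro i
  rw [Real.dist_eq]
  exact abs_sub_le_of_mem_latticeRefinement I.hK ht hx hy i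

/-- Mesh of the refinement is at most `τ`. [folklore] -/
theorem dist_le_tau_of_mem_P {t : Finset (Fin N → ℝ)} (ht : t ∈ S.P.faces) {x y : Fin N → ℝ}
    (hx : x ∈ convexHull ℝ (t : Set (Fin N → ℝ))) (hy : y ∈ convexHull ℝ (t : Set (Fin N → ℝ))) :
    dist x y ≤ S.τ :=
  (S.dist_le_of_mem_P ht hx hy).trans S.hm_τ

/-- Non-degeneracy of the simplices of the refinement. [folklore] -/
theorem nondegenerate_of_mem_P {t : Finset (Fin N → ℝ)} (ht : t ∈ S.P.faces) : Nondegenerate S.c t :=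
  nondegenerate_of_mem_latticeRefinement I.hK S.hcnd ht

/-- **The refinement is pure**: every simplex is a face of a simplex with `n + 1` vertices
(triangulations of a simplex are pure, applied inside each top simplex of `K`). [folklore] -/
theorem exists_subset_card_of_mem_P {t : Finset (Fin N → ℝ)} (ht : t ∈ S.P.faces) :
    ∃ t' ∈ S.P.faces, t ⊆ t' ∧ t'.card = n + 1 := by
  classical
  obtain ⟨s, hs, hts⟩ := S.exists_top_of_mem_P ht
  -- the subcomplex of simplices inside `convexHull s`
  set Fs : Set (Finset (Fin N → ℝ)) := {r | r ∈ S.P.faces ∧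
    convexHull ℝ (r : Set (Fin N → ℝ)) ⊆ convexHull ℝ (s : Set (Fin N → ℝ))} with hFs
  have hFsub : Fs ⊆ S.P.faces := fun r hr => hr.1
  have hFdown : ∀ r ∈ Fs, ∀ r' ⊆ r, r'.Nonempty → r' ∈ Fs := fun r hr r' hr' hne =>
    ⟨S.P.down_closed hr.1 hr' hne, (convexHull_mono (by exact_mod_cast hr')).trans hr.2⟩
  set Ps := subcomplexOf S.P Fs hFsub hFdown with hPs
  have hPsfin : Ps.faces.Finite := S.P_finite.subset hFsub
  have hcov : convexHull ℝ (s : Set (Fin N → ℝ)) ⊆ Ps.space := fun x hx => by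
    obtain ⟨r, hr, hxr, hrs⟩ := S.exists_mem_P_of_mem hs.1 hx
    exact Geometry.SimplicialComplex.convexHull_subset_space (K := Ps) ⟨hr, hrs⟩ hxr
  obtain ⟨t', ht', htt', hcard⟩ := exists_subset_card_eq_of_triangulation Ps hPsfin (I.K.indep hs.1) hs.2
    (fun r hr => hr.2) hcov (t := t) ⟨ht, hts⟩
  exact ⟨t', ht'.1, htt', hcard⟩

/-- The top simplices of the refinement. [folklore] -/
def PTop : Set (Finset (Fin N → ℝ)) := {t | t ∈ S.P.faces ∧ t.card = n + 1}

/-- Directions of a refined simplex lie in the direction space of the top simplex of `K`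
containing it. [folklore] -/
theorem vectorSpan_le_of_subset {t s : Finset (Fin N → ℝ)}
    (hts : convexHull ℝ (t : Set (Fin N → ℝ)) ⊆ convexHull ℝ (s : Set (Fin N → ℝ))) :
    vectorSpan ℝ (t : Set (Fin N → ℝ)) ≤ vectorSpan ℝ (s : Set (Fin N → ℝ)) := by
  calc vectorSpan ℝ (t : Set (Fin N → ℝ)) ≤ vectorSpan ℝ (convexHull ℝ (s : Set (Fin N → ℝ))) :=
        vectorSpan_mono ℝ ((subset_convexHull ℝ _).trans hts)
    _ = vectorSpan ℝ (s : Set (Fin N → ℝ)) := by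
        rw [← direction_affineSpan, affineSpan_convexHull, direction_affineSpan]

/-! ### The secant map `Λ` -/

/-- The simplexwise secant map of `F = e ∘ f` on the refinement. [folklore] -/
def Λ : (Fin N → ℝ) → 𝔼 n := plMap S.P I.F

/-- The secant map of a simplex of the refinement (an affine map). [folklore] -/
def A (t : Finset (Fin N → ℝ)) (ht : t ∈ S.P.faces) : (Fin N → ℝ) →ᵃ[ℝ] 𝔼 n :=
  interp t (S.P.indep ht) I.F

/-- Auxiliary step of the bending construction (`Λ_eqOn`). [folklore] -/
theorem Λ_eqOn {t : Finset (Fin N → ℝ)} (ht : t ∈ S.P.faces) :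
    EqOn S.Λ (S.A t ht) (convexHull ℝ (t : Set (Fin N → ℝ))) := plMap_eqOn_interp ht

/-- Auxiliary step of the bending construction (`A_apply_of_mem`). [folklore] -/
theorem A_apply_of_mem {t : Finset (Fin N → ℝ)} (ht : t ∈ S.P.faces) {v : Fin N → ℝ} (hv : v ∈ t) :
    S.A t ht v = I.F v := interp_apply_of_mem _ _ hv

/-- `Λ` is continuous on the underlying space. [folklore] -/
theorem continuousOn_Λ : ContinuousOn S.Λ I.K.space := by
  rw [← S.P_space]
  exact continuousOn_plMap S.P_finite I.F

/-! ### Active simplices and the estimates -/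


/-- On an active part of a top simplex of `K`, `F` is the model `G s`. [folklore] -/
theorem F_eq_G {s : Finset (Fin N → ℝ)} (hs : s ∈ I.Top) {x : Fin N → ℝ}
    (hx : x ∈ convexHull ℝ (s : Set (Fin N → ℝ))) (hxD : x ∈ I.D) : I.F x = S.G s x :=
  (S.hmodel s hs).2.2.2.1 ⟨hx, hxD.2⟩

/-- The `C⁰` displacement bound `δ₀ = B₁ / m`. [folklore] -/
def δ₀ : ℝ := S.B₁ / S.m

/-- Auxiliary step of the bending construction (`δ₀_nonneg`). [folklore] -/
theorem δ₀_nonneg : 0 ≤ S.δ₀ := by unfold δ₀; positivity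

/-- Auxiliary step of the bending construction (`δ₀_le_εreq`). [folklore] -/
theorem δ₀_le_εreq : S.δ₀ ≤ I.εreq := S.hm_δ.trans (min_le_right _ _)

/-- Auxiliary step of the bending construction (`δ₀_le`). [folklore] -/
theorem δ₀_le : S.δ₀ ≤ min (S.ρP / 4) (I.η / 8) / 8 := S.hm_δ.trans (min_le_left _ _)

/-- **`C⁰` estimate** (Munkres 9.3): on an active top simplex of the refinement inside the top
simplex `s` of `K`, the secant map is within `δ₀` of the model. [folklore] -/
theorem norm_A_sub_G_le {s : Finset (Fin N → ℝ)} (hs : s ∈ I.Top) {t : Finset (Fin N → ℝ)}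
    (ht : t ∈ S.P.faces) (hts : convexHull ℝ (t : Set (Fin N → ℝ)) ⊆ convexHull ℝ (s : Set (Fin N → ℝ)))
    (htZ : convexHull ℝ (t : Set (Fin N → ℝ)) ⊆ I.Zact) {x : Fin N → ℝ}
    (hx : x ∈ convexHull ℝ (t : Set (Fin N → ℝ))) : ‖S.A t ht x - S.G s x‖ ≤ S.δ₀ := by
  have hQ : convexHull ℝ (t : Set (Fin N → ℝ)) ⊆ convexHull ℝ (s : Set (Fin N → ℝ)) ∩ I.Zact :=
    subset_inter hts htZ
  have hLip := ((S.hmodel s hs).2.2.2.2.2.2.1 _ (convex_convexHull ℝ _) hQ).1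
  refine norm_secant_sub_le (fun v hv => ?_) hx fun v hv => ?_
  · rw [S.A_apply_of_mem ht hv]
    exact S.F_eq_G hs (hts (subset_convexHull ℝ _ hv)) (I.Zact_subset_D (htZ (subset_convexHull ℝ _ hv)))
  · have h := hLip.dist_le_mul _ (subset_convexHull ℝ _ hv) _ hx
    rw [dist_eq_norm, dist_comm] at h
    calc ‖S.G s v - S.G s x‖ ≤ S.B₁ * dist x v := h
      _ ≤ S.B₁ * (1 / S.m) := mul_le_mul_of_nonneg_left (S.dist_le_of_mem_P ht hx (subset_convexHull ℝ _ hv)) S.B₁.2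
      _ = S.δ₀ := by unfold δ₀; ring

end BendSetup



end BendInput



end Literature.Topology.FourManifolds
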